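import Summits.BirchSwinnertonDyer.BirchSwinnertonDyer.Theorems.AlignedTransportAtTwoBSDOfMainConjectureRankOneAtTwoLeadingTermFinal
import Summits.BirchSwinnertonDyer.BirchSwinnertonDyer.Theorems.AlignedTransportAtTwoBSDOfMainConjectureRankOneAtTwoSimpleZero
import Literature.NumberTheory.EllipticCurves.PAdicBSDGoodOrdinaryRankOne
import Literature.NumberTheory.EllipticCurves.MordellWeilProofs
import Literature.Barriers.BirchSwinnertonDyer.ExceptionalZero
import HarnessLib

/-!
# Route `AlignedTransportAtTwo`, crux C3′ `BSDOfMainConjectureRankOneAtTwo` (stmt-BirchSwinnertonDyer-23008), line `birth` v3 —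
# the line's stub L2 `F1Sign2.PerrinRiouComparisonAtTwo` (T-23008-b) is a THEOREM from the PRINTED Disegni 2020 Thm. 1 at `p = 2`,
# and the crux BY NAME from ONE open statement (the bare Schneider leading-term FORMULA at `2`) + four published facts

HONEST FRAMING (cell `bsd-f1-sign2`, lead seat `bsd-line-att-p1` g4). BSD is NOT proved; C3′ is NOT closed. THEOREMS ONLY; nothing asserted;
`--supports stmt-BirchSwinnertonDyer-23008`. What changed since line `birth` v2 (lead g2, closure p598696
`…LeadingTermFinal.bsdOfMainConjectureRankOneAtTwo_of_schneiderAtTwo_of_perrinRiouAtTwo`: C3′ ⟸ T-23008-a ∧ T-23008-b ∧ GZK ∧ modularity ∧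
Mazur–Tate `Σ²`): the typer (-ty g7) landed the NAMED PRINTED FACT `Literature.NumberTheory.EllipticCurves.Disegni2020.padicBSD_goodOrd_rankOne`
(p606485; Disegni, Kyoto J. Math. 60 (2020), Thm. 1 = Thm. 4 first bullet, EVERY ordinary `p`, `p = 2` INCLUDED, placement REF2-PLACEMENT-v17 §1 (A)):
in analytic rank one at a good ordinary `p`, `#Ш_an ∈ ℚ` and, for THE canonical `p`-adic height `D` (`IsCanonicalSq`), every newform `f` and
period ratio `ϖ`: `ϖ · [T¹]L_p(f,α) · log_p γ · #tors² = (1 − α⁻¹)² · #Ш_an · Reg_p(D) · ∏ c_v`.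

* §1 `perrinRiouComparisonAtTwo_of_disegni` — **T-23008-b DISCHARGED FROM PRINT**: Disegni's identity at `p = 2`, divided by `#tors² ≠ 0`
  (`torsionOrder_pos_holds`) and read against Miller's `#Ш_an = L′(E,1)·tors²/(Ω_E·∏c_v·Reg_∞)` (`shaAn_def`; `Ω_E, Reg_∞, ∏c_v > 0` by the tree's
  discharged positivity facts), IS Perrin-Riou's rank-one comparison at `2` with the witness `q = #Ш_an · ∏c_v / tors²` — even in EXACT form
  (`perrinRiouComparisonAtTwo_exact_of_disegni`), a fortiori in the filed NORM form. So the cell conjecture `PerrinRiouComparisonAtTwo` (filed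
  p598374 as OPEN at `2`) is a theorem of the printed record + the `Σ²` height convention its receptacle carries (see the fact's docstring).
* §2 `schneiderConjecture_of_disegni_of_order_eq_one` — on the C3′ cell the SIMPLE-ZERO binder `ord_T L₂(f_E) = 1` and Disegni's identity
  force `Reg₂(D) ≠ 0` for the canonical `D` (left side `ϖ·[T¹]L₂·log₂5·tors² ≠ 0`): Schneider's non-degeneracy is OUTPUT, not input, on the cell.
* §3 `bsdOfMainConjectureRankOneAtTwo_of_leadingTermFormulaAtTwo_of_disegni` — the crux BY NAME from the WEAKEST open input this line has had:
  ONLY clause (3) of T-23008-a — the bare Schneider / Perrin-Riou / BMS Thm 1.7 (3) leading-term FORMULA for a characteristic generator at `p = 2`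
  over the `Σ²` receptacle, GIVEN `Reg₂ ≠ 0` and `Ш[2^∞]` finite (both now supplied: §2 and Gross–Zagier–Kolyvagin) — plus Disegni (PRINT), GZK
  (PRINT), modularity (PRINT), Mazur–Tate `Σ²` at `2` (PRINT). Clauses (1) `rank ≤ ord_T f_E` and (2) `ord_T f_E = rank ↔ (Reg₂ ≠ 0 ∧ Ш[2^∞] finite)`
  of T-23008-a are NO LONGER USED. Mechanism: main conjecture ⇒ generator `g`, `ι g = ϖ·L₂`; the formula at `g` and the adapter
  `leadingTermLaw_of_schneiderShape_of_mazurMainConjecture` (p594549) give `A·tors² = u·#Ш[2^∞]·B·Tam` with `A = ϖ·[T¹]L₂·log₂5`,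
  `B = (1−α⁻¹)²·Reg₂ ≠ 0`; Disegni gives the EXACT comparison `q·B = A`, `q·Ω_E·Reg_∞ = L′(E,1)`; L3 `bsdp_of_leadingTerm_of_comparison` (p594193) concludes.
* §4 `bsdOfMainConjectureRankOneAtTwo_of_schneiderAtTwo_of_disegni` — the same with T-23008-a BY NAME (`F1Sign2.SchneiderLeadingTermAtTwoSq`, of
  which §3's hypothesis is literally conjunct (3)): the composition of skeleton `Lines/birth.lean` v3 (stubs: modularity, GZK, `Σ²`, Disegni —
  PRINT; `stub_schneiderAtTwo` — OPEN). C3′ = ONE open statement at `2` + four published facts.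

References: [Disegni2020] Thm. 1 / Thm. 4 (i), Prop. 2; [PerrinRiou1987] (the comparison at good ordinary odd p); [BalakrishnanMullerStein2015]
Thm. 1.7 (3) (leading term, p > 2); [Schneider1985] Thm. 2′; [Miller2011LMS] Def. 1.1; [GrossZagier1986], [Kolyvagin1990]; [MazurTate1991] Thm. 3.1.
-/

set_option autoImplicit false
-- the route's Theorems namespace repeats a component by design (summit = sub-problem, D-0017).
set_option linter.dupNamespace false

noncomputable section

open scoped Classical MatrixGroups ModularForm

open CongruenceSubgroup WeierstrassCurve Literature.NumberTheory.EllipticCurves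
  Literature.NumberTheory.EllipticCurves.ModularForms Literature.NumberTheory.EllipticCurves.Greenberg1999
  Summit.BirchSwinnertonDyer.Rank1Residual.F1Sign2
  Summit.BirchSwinnertonDyer.BirchSwinnertonDyer.Theorems.Rank1ResidualX1Defs
  Summit.BirchSwinnertonDyer.BirchSwinnertonDyer.Theorems.AlignedTransportAtTwoOrderTransfer
  Summit.BirchSwinnertonDyer.BirchSwinnertonDyer.Theorems.AlignedTransportAtTwoLeadingTermAlgebra

namespace Summit.BirchSwinnertonDyer.BirchSwinnertonDyer.Theorems.AlignedTransportAtTwoDisegni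

/-! ## §1 T-23008-b from print: Disegni 2020 Thm. 1 at `p = 2` ⇒ `PerrinRiouComparisonAtTwo` -/

/-- **Perrin-Riou's rank-one comparison at `p = 2`, EXACT form, from Disegni 2020 Thm. 1.** For `W/ℚ` globally minimal, good ordinary at `2`,
of analytic rank one, every newform `f` of `W` (any level), every `ϖ` with `ϖ · Ω_E = Ω⁺_f` and every canonical (`Σ²`) `2`-adic height datum `Dh`:
the rational number `q = #Ш_an · ∏ c_v / #E(ℚ)_tors²` satisfies `q · (1 − α⁻¹)² · Reg₂(Dh) = ϖ · [T¹]L₂(f,α) · log₂ γ` in `ℚ₂` and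
`q · Ω_E · Reg_∞(E) = L′(E,1)` in `ℂ`. Proof: Disegni's identity divided by `#tors² ≠ 0`; the archimedean clause is Miller's definition of `#Ш_an`
with `Ω_E, ∏ c_v, Reg_∞, #tors` nonzero (tree discharges `realPeriodRat_pos_holds`, `tamagawaProduct_pos_holds`, `regulator_pos'`,
`torsionOrder_pos_holds`). CONDITIONAL on the named printed fact `hD`. [cite: Disegni2020, Thm. 1 = Thm. 4 (i), Prop. 2] [cite: Miller2011LMS, §1] -/
theorem perrinRiouComparisonAtTwo_exact_of_disegni (hD : Disegni2020.padicBSD_goodOrd_rankOne)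
    (W : WeierstrassCurve ℚ) [W.IsElliptic] [W.IsGloballyMinimal] (hord : IsOrdinaryAt W 2) (hr : W.analyticRank = 1)
    {N : ℕ} [NeZero N] {f : CuspForm (Gamma0 N) 2} (hf : IsNewformOf W f)
    {ϖ : ℚ} (hϖ : (ϖ : ℝ) * W.realPeriodRat = plusPeriod f) {Dh : PAdicHeightData W 2} (hDh : Dh.IsCanonicalSq) :
    ∃ q : ℚ,
      (q : ℚ_[2]) * ((1 - (unitRoot W 2 : ℚ_[2])⁻¹) ^ 2 * padicRegulator Dh) =
          (ϖ : ℚ_[2]) * PowerSeries.coeff 1 (padicLFunction f (unitRoot W 2 : ℚ_[2])) *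
            padicLog 2 (cyclotomicGenerator 2) ∧
      (q : ℂ) * ((W.realPeriodRat : ℂ) * (W.regulator : ℂ)) = W.leadingLCoeff := by
  obtain ⟨qD, hsha, hid⟩ := hD W 2 hord hr
  have hI := hid Dh hDh f hf ϖ hϖ
  -- nonvanishing of the arithmetic and archimedean factors
  have ht0 : 0 < W.torsionOrder := W.torsionOrder_pos_holds
  have htP : (W.torsionOrder : ℚ_[2]) ≠ 0 := by exact_mod_cast ht0.ne'
  have htC : (W.torsionOrder : ℂ) ≠ 0 := by exact_mod_cast ht0.ne'
  have htQ : (W.torsionOrder : ℚ) ≠ 0 := by exact_mod_cast ht0.ne'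
  have hΩ : (W.realPeriodRat : ℂ) ≠ 0 := by exact_mod_cast W.realPeriodRat_pos_holds.ne'
  have hR : (W.regulator : ℂ) ≠ 0 := by exact_mod_cast (W.regulator_pos').ne'
  have hc0 : 0 < W.tamagawaProduct := W.tamagawaProduct_pos_holds
  have hcC : (W.tamagawaProduct : ℂ) ≠ 0 := by exact_mod_cast hc0.ne'
  refine ⟨qD * W.tamagawaProduct / (W.torsionOrder : ℚ) ^ 2, ?_, ?_⟩
  · -- `2`-adic clause: Disegni's identity divided by `tors²`
    have hcast : ((qD * W.tamagawaProduct / (W.torsionOrder : ℚ) ^ 2 : ℚ) : ℚ_[2]) =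
        (qD : ℚ_[2]) * (W.tamagawaProduct : ℚ_[2]) / (W.torsionOrder : ℚ_[2]) ^ 2 := by
      push_cast; ring
    rw [hcast, div_mul_eq_mul_div, div_eq_iff (pow_ne_zero 2 htP), hI]
    ring
  · -- archimedean clause: Miller's `#Ш_an`
    have hsha' : W.leadingLCoeff * (W.torsionOrder : ℂ) ^ 2 /
        ((W.realPeriodRat : ℂ) * (W.tamagawaProduct : ℂ) * (W.regulator : ℂ)) = (qD : ℂ) := by
      rw [← shaAn_def]; exact hsha
    rw [div_eq_iff (mul_ne_zero (mul_ne_zero hΩ hcC) hR)] at hsha'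
    have hcast : ((qD * W.tamagawaProduct / (W.torsionOrder : ℚ) ^ 2 : ℚ) : ℂ) =
        (qD : ℂ) * (W.tamagawaProduct : ℂ) / (W.torsionOrder : ℂ) ^ 2 := by
      push_cast; ring
    rw [hcast, div_mul_eq_mul_div, div_eq_iff (pow_ne_zero 2 htC), hsha']
    ring

/-- **T-23008-b `F1Sign2.PerrinRiouComparisonAtTwo` IS A THEOREM OF THE PRINTED RECORD** (modulo the `Σ²`-receptacle convention carried by
`IsCanonicalSq`, see the fact's docstring): Disegni 2020 Thm. 1 at `p = 2` implies the cell's filed NORM-form comparison (p598374), with the witness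
of `perrinRiouComparisonAtTwo_exact_of_disegni` (norms of equal things are equal; the hypothesis `Reg₂ ≠ 0` of the filed statement is not even used).
CONDITIONAL on the named printed fact `hD`; discharges stub L2 `stub_perrinRiouAtTwo` of line `birth` v2 of crux C3′.
[cite: Disegni2020, Thm. 1 = Thm. 4 (i)] [cite: PerrinRiou1987, (rank-one comparison, good ordinary odd p)] -/
theorem perrinRiouComparisonAtTwo_of_disegni (hD : Disegni2020.padicBSD_goodOrd_rankOne) : PerrinRiouComparisonAtTwo := by
  intro W _ _ hord _ hr _ f hf ϖ hϖ Dh hDh _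
  obtain ⟨q, hq1, hq2⟩ := perrinRiouComparisonAtTwo_exact_of_disegni hD W hord hr hf hϖ hDh
  exact ⟨q, by rw [hq1], hq2⟩

/-! ## §2 Schneider's non-degeneracy at `2` is OUTPUT on the C3′ cell -/

/-- **`Reg₂ ≠ 0` from the simple zero.** For `W` good ordinary at `2` of analytic rank one, a newform `f` of `W`, `ϖ · Ω_E = Ω⁺_f`, and
`ord_T L₂(f, α) = 1`: Disegni's identity for the canonical `Dh` has a NONZERO left side (`ϖ ≠ 0` as `Ω⁺_f > 0`; `[T¹]L₂ ≠ 0` is the simple zero,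
`order_padicLFunction_eq_one_iff_coeff_one_ne_zero`; `log₂ γ ≠ 0`, `padicLog_cyclotomicGenerator_ne_zero`; `#tors ≥ 1`), hence `Reg₂(Dh) ≠ 0`,
i.e. `SchneiderConjecture Dh`. CONDITIONAL on the named printed fact `hD`. [cite: Disegni2020, Thm. 1] [cite: Schneider1982PadicHeightI, §1] -/
theorem schneiderConjecture_of_disegni_of_order_eq_one (hD : Disegni2020.padicBSD_goodOrd_rankOne)
    (W : WeierstrassCurve ℚ) [W.IsElliptic] [W.IsGloballyMinimal] (hord : IsOrdinaryAt W 2) (hr : W.analyticRank = 1)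
    {N : ℕ} [NeZero N] {f : CuspForm (Gamma0 N) 2} (hf : IsNewformOf W f)
    {ϖ : ℚ} (hϖ : (ϖ : ℝ) * W.realPeriodRat = plusPeriod f)
    (hL : (padicLFunction f (unitRoot W 2 : ℚ_[2])).order = 1)
    {Dh : PAdicHeightData W 2} (hDh : Dh.IsCanonicalSq) : SchneiderConjecture Dh := by
  obtain ⟨qD, -, hid⟩ := hD W 2 hord hr
  have hI := hid Dh hDh f hf ϖ hϖ
  -- the left side is nonzero
  have hϖ0 : ϖ ≠ 0 := by
    rintro rfl
    have hper : 0 < plusPeriod f := IsNewform0.plusPeriod_pos_holds hf.1 hf.coeffField_eq_bot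
    rw [← hϖ, Rat.cast_zero, zero_mul] at hper
    exact lt_irrefl _ hper
  have hc : (ϖ : ℚ_[2]) ≠ 0 := by exact_mod_cast hϖ0
  have h1 : PowerSeries.coeff 1 (padicLFunction f (unitRoot W 2 : ℚ_[2])) ≠ 0 :=
    (order_padicLFunction_eq_one_iff_coeff_one_ne_zero W 2 hord hf hr).mp hL
  have hlog : padicLog 2 (cyclotomicGenerator 2 : ℚ_[2]) ≠ 0 :=
    Literature.Barriers.BirchSwinnertonDyer.padicLog_cyclotomicGenerator_ne_zero 2
  have htP : (W.torsionOrder : ℚ_[2]) ≠ 0 := by exact_mod_cast (W.torsionOrder_pos_holds).ne'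
  have hLHS : (ϖ : ℚ_[2]) * PowerSeries.coeff 1 (padicLFunction f (unitRoot W 2 : ℚ_[2])) *
      padicLog 2 (cyclotomicGenerator 2) * (W.torsionOrder : ℚ_[2]) ^ 2 ≠ 0 :=
    mul_ne_zero (mul_ne_zero (mul_ne_zero hc h1) hlog) (pow_ne_zero 2 htP)
  rw [hI] at hLHS
  -- so the regulator factor of the right side is nonzero
  intro hReg
  apply hLHS
  rw [hReg]; ring

/-! ## §3 The crux from the bare leading-term FORMULA at `2` (clause (3) of T-23008-a) + four published facts -/

/-- **C3′ from the WEAKEST open input of the line (CONDITIONAL; closes nothing).** Hypothesis `ha3` = conjunct (3) ALONE of the cell statement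
`F1Sign2.SchneiderLeadingTermAtTwoSq` (T-23008-a; Schneider 1985 Thm 2′ / BMS 2016 Thm 1.7 (3) read at `p = 2` over the `Σ²` receptacle — NOT in
print at `2`): for `W` good ordinary at `2`, every cyclotomic datum, every torsion Selmer dual with characteristic generator `f_E`, and THE canonical
`Dh`, IF `Reg₂(Dh) ≠ 0` and `Ш[2^∞]` is finite THEN `[T^r]f_E · (log₂ γ)^r · tors² = u · (1 − α⁻¹)² · #Ш[2^∞] · Reg₂(Dh) · ∏ c_v`, `u ∈ ℤ₂ˣ`,
`r = rank E(ℚ)`. With Disegni 2020 Thm. 1 (`hD`, PRINT at `2`), Gross–Zagier–Kolyvagin (`hGZK`), modularity (`hmod`) and the Mazur–Tate `Σ²` series at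
`2` (`hMT`) this gives `BSDOfMainConjectureRankOneAtTwo`: GZK ⇒ `rank = 1`, `Ш` finite; modularity ⇒ `f_E`, `ϖ > 0`; `hMT` ⇒ canonical `Dh`; §2 ⇒
`Reg₂(Dh) ≠ 0`; the main conjecture (a binder of the crux) ⇒ generator `g`, `ι g = ϖ · L₂`, and `ha3` at `g` through the adapter
`leadingTermLaw_of_schneiderShape_of_mazurMainConjecture` ⇒ `A · tors² = u · #Ш[2^∞] · B · Tam`, `A = ϖ·[T¹]L₂·log₂γ`, `B = (1−α⁻¹)²·Reg₂(Dh) ≠ 0`;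
Disegni ⇒ the EXACT comparison `q · B = A ∧ q · Ω_E · Reg_∞ = L′(E,1)`; `bsdp_of_leadingTerm_of_comparison` concludes. Clauses (1)–(2) of
T-23008-a are not used. BSD is not proved; C3′ stays open modulo exactly `ha3` and four published facts.
[cite: BalakrishnanMullerStein2015, Thm. 1.7 (3)] [cite: Schneider1985, Thm. 2′] [cite: Disegni2020, Thm. 1] [cite: Miller2011LMS, Def. 1.1] -/
theorem bsdOfMainConjectureRankOneAtTwo_of_leadingTermFormulaAtTwo_of_disegni
    (ha3 : ∀ (W : WeierstrassCurve ℚ) [W.IsElliptic] [W.IsGloballyMinimal],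
      W.HasGoodReductionAtPrime 2 → ¬ (2 : ℤ) ∣ W.frobeniusTrace 2 →
      ∀ (κ : ZpExtension ℚ 2) (γ : Field.absoluteGaloisGroup ℚ),
        κ.IsCyclotomic → κ.IsTopGenerator γ → IsCyclotomicVariable 2 γ →
      ∀ (D : W.SelmerDualData κ γ) [Module.Finite (IwasawaAlgebra 2) D.X], D.IsTorsion →
      ∀ (fE : IwasawaAlgebra 2), D.charIdeal = Ideal.span {fE} →
      ∀ (Dh : PAdicHeightData W 2), Dh.IsCanonicalSq →
        SchneiderConjecture Dh → Finite (AddCommGroup.primaryComponent W.sha 2) →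
        ∃ u : ℤ_[2]ˣ,
          ((PowerSeries.coeff W.mordellWeilRank fE : ℤ_[2]) : ℚ_[2]) *
              padicLog 2 (cyclotomicGenerator 2) ^ W.mordellWeilRank * (W.torsionOrder : ℚ_[2]) ^ 2 =
            ((u : ℤ_[2]) : ℚ_[2]) *
              ((1 - (unitRoot W 2 : ℚ_[2])⁻¹) ^ 2 *
                ((Nat.card (AddCommGroup.primaryComponent W.sha 2) : ℚ_[2]) * padicRegulator Dh * W.tamagawaProduct)))
    (hD : Disegni2020.padicBSD_goodOrd_rankOne)
    (hGZK : rank_eq_analyticRank_of_analyticRank_le_one) (hmod : nonempty_modularParametrizationData)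
    (hMT : mazurTate_sigmaSq_existsUnique_two) :
    Summit.BirchSwinnertonDyer.BirchSwinnertonDyer.Theses.AlignedTransportAtTwo.BSDOfMainConjectureRankOneAtTwo := by
  intro W _ _ _ hord ht _ hr hL hMC
  haveI : NeZero (W.conductorNorm ℤ) := ⟨(W.conductorNorm_pos_holds).ne'⟩
  -- rank one and finiteness of `Ш` (GZK)
  obtain ⟨hrank, hfinSha⟩ := hGZK W (le_of_eq hr)
  have hrank1 : W.mordellWeilRank = 1 := by rw [hrank, hr]
  haveI : Finite W.sha := hfinSha
  have hfin2 : Finite (AddCommGroup.primaryComponent W.sha 2) := inferInstance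
  -- the conductor-level newform and its period ratio (modularity datum)
  obtain ⟨Dm⟩ := hmod W
  obtain ⟨ϖ, hϖpos, hϖ, -⟩ := Dm.exists_rat_mul_realPeriodRat_eq_plusPeriod
  have hf : IsNewformOf W Dm.f := Dm.isNewformOf
  have hL1 : (padicLFunction Dm.f (unitRoot W 2 : ℚ_[2])).order = 1 := hL Dm.f hf
  -- THE canonical `2`-adic height (`Σ²` receptacle) and its non-degeneracy (§2)
  obtain ⟨Dh, hDh⟩ := exists_isCanonicalSq_two hMT W hord.1 hord.2
  have hSch : SchneiderConjecture Dh := schneiderConjecture_of_disegni_of_order_eq_one hD W hord hr hf hϖ hL1 hDh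
  -- `B = ε₂ · Reg₂(Dh) ≠ 0`
  set ε : ℚ_[2] := (1 - (unitRoot W 2 : ℚ_[2])⁻¹) ^ 2 with hε
  have hε0 : ε ≠ 0 := by
    obtain ⟨u₂, hu₂⟩ := exists_unit_one_sub_unitRoot_inv 2 W hord
    have hN : (W.reductionPointCount 2 : ℚ_[2]) ≠ 0 := by exact_mod_cast (W.reductionPointCount_pos 2).ne'
    have hu1 : ‖((u₂ : ℤ_[2]) : ℚ_[2])‖ = 1 := PadicInt.isUnit_iff.mp u₂.isUnit
    have hu0 : ((u₂ : ℤ_[2]) : ℚ_[2]) ≠ 0 := by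
      rw [← norm_pos_iff, hu1]; exact one_pos
    rw [hε, hu₂]
    exact pow_ne_zero 2 (mul_ne_zero hu0 hN)
  have hB : ε * padicRegulator Dh ≠ 0 := mul_ne_zero hε0 hSch
  -- the formula `ha3` packaged as the adapter's Schneider-shaped law (the order premise is not needed)
  have hS : ∀ (κ : ZpExtension ℚ 2) (γ : Field.absoluteGaloisGroup ℚ),
      κ.IsCyclotomic → κ.IsTopGenerator γ → IsCyclotomicVariable 2 γ →
      ∀ (D : W.SelmerDualData κ γ) [Module.Finite (IwasawaAlgebra 2) D.X], D.IsTorsion →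
      ∀ fE : IwasawaAlgebra 2, D.charIdeal = Ideal.span {fE} → fE.order = (W.mordellWeilRank : ℕ∞) →
        ∃ u : ℤ_[2]ˣ, ((PowerSeries.coeff 1 fE : ℤ_[2]) : ℚ_[2]) * padicLog 2 (cyclotomicGenerator 2) *
            (W.torsionOrder : ℚ_[2]) ^ 2 =
          ((u : ℤ_[2]) : ℚ_[2]) * (Nat.card (AddCommGroup.primaryComponent W.sha 2) : ℚ_[2]) * (ε * padicRegulator Dh) *
            (W.tamagawaProduct : ℚ_[2]) := by
    intro κ γ hκ hγ hγ' D _ hX fE hchar _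
    obtain ⟨u, hu⟩ := ha3 W hord.1 hord.2 κ γ hκ hγ hγ' D hX fE hchar Dh hDh hSch hfin2
    rw [hrank1, pow_one] at hu
    exact ⟨u, by rw [hu]; ring⟩
  -- the leading-term law (adapter) and the EXACT comparison law (Disegni), same `A`, `B`
  have hLT := leadingTermLaw_of_schneiderShape_of_mazurMainConjecture W 2 hf hϖ hS hrank1 hL1 hMC
  obtain ⟨q, hq1, hq2⟩ := perrinRiouComparisonAtTwo_exact_of_disegni hD W hord hr hf hϖ hDh
  exact bsdp_of_leadingTerm_of_comparison W 2 hGZK (le_of_eq hr) hB hLT ⟨q, hq1, hq2⟩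

/-! ## §4 The composition of skeleton v3: T-23008-a BY NAME + Disegni + GZK + modularity + Mazur–Tate `Σ²` ⇒ C3′ -/

/-- **C3′ BY NAME from `F1Sign2.SchneiderLeadingTermAtTwoSq` (OPEN at `2`) and four PUBLISHED facts** — Disegni 2020 Thm. 1 (`p = 2` included),
Gross–Zagier–Kolyvagin, modularity (parametrisation datum), the Mazur–Tate `Σ²` series at `2`. Conjunct (3) of `ha` is §3's hypothesis; conjuncts
(1)–(2) are discarded. This is the composition of line `birth` v3 of crux C3′ (stub L2 `PerrinRiouComparisonAtTwo` of v2 is gone — §1). CONDITIONAL;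
closes nothing; BSD is not proved. [cite: BalakrishnanMullerStein2015, Thm. 1.7] [cite: Disegni2020, Thm. 1] [cite: Miller2011LMS, Def. 1.1] -/
theorem bsdOfMainConjectureRankOneAtTwo_of_schneiderAtTwo_of_disegni (ha : SchneiderLeadingTermAtTwoSq)
    (hD : Disegni2020.padicBSD_goodOrd_rankOne) (hGZK : rank_eq_analyticRank_of_analyticRank_le_one)
    (hmod : nonempty_modularParametrizationData) (hMT : mazurTate_sigmaSq_existsUnique_two) :
    Summit.BirchSwinnertonDyer.BirchSwinnertonDyer.Theses.AlignedTransportAtTwo.BSDOfMainConjectureRankOneAtTwo :=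
  bsdOfMainConjectureRankOneAtTwo_of_leadingTermFormulaAtTwo_of_disegni
    (fun W _ _ hg ho κ γ hκ hγ hγ' D _ hX fE hchar Dh hDh hSch hfin =>
      (ha W hg ho κ γ hκ hγ hγ' D hX fE hchar Dh hDh).2.2 hSch hfin)
    hD hGZK hmod hMT

/-- The v2 composition recovered (sanity; CONDITIONAL): T-23008-a BY NAME + Disegni + the three other facts ⇒ C3′ ALSO through the g2 closure
`…LeadingTermFinal.bsdOfMainConjectureRankOneAtTwo_of_schneiderAtTwo_of_perrinRiouAtTwo` with T-23008-b supplied by §1. [cite: Disegni2020, Thm. 1] -/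
theorem bsdOfMainConjectureRankOneAtTwo_of_schneiderAtTwo_of_disegni' (ha : SchneiderLeadingTermAtTwoSq)
    (hD : Disegni2020.padicBSD_goodOrd_rankOne) (hGZK : rank_eq_analyticRank_of_analyticRank_le_one)
    (hmod : nonempty_modularParametrizationData) (hMT : mazurTate_sigmaSq_existsUnique_two) :
    Summit.BirchSwinnertonDyer.BirchSwinnertonDyer.Theses.AlignedTransportAtTwo.BSDOfMainConjectureRankOneAtTwo :=
  AlignedTransportAtTwoLeadingTermFinal.bsdOfMainConjectureRankOneAtTwo_of_schneiderAtTwo_of_perrinRiouAtTwo ha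
    (perrinRiouComparisonAtTwo_of_disegni hD) hGZK hmod hMT

end Summit.BirchSwinnertonDyer.BirchSwinnertonDyer.Theorems.AlignedTransportAtTwoDisegni

end
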